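import Summits.BirchSwinnertonDyer.BirchSwinnertonDyer.Theorems.TameQuarticSolventSolventPairLowerBoundTwistTprime
import Summits.BirchSwinnertonDyer.Rank1Residual.Additive.GordDescent
import Literature.NumberTheory.EllipticCurves.GlobalMinimalModelProofs
import Literature.NumberTheory.EllipticCurves.LFunctionSmulProofs
import Literature.NumberTheory.EllipticCurves.AnalyticRankOrderProofs
import Literature.NumberTheory.EllipticCurves.AnalyticRankModularityProofs
import HarnessLib

/-!
# Route `TameQuarticSolvent`, crux `SolventPairLowerBound` (stmt-BirchSwinnertonDyer-21391), line `birth` —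
# stub `stub_twistDatum` REDUCED to its analytic input: an admissible rank-zero twist datum exists as soon as
# some `d > 0` with `ord₃ d = 1` has `L(E^{(d)}, 1) ≠ 0`

HONEST FRAMING. Theorems only; helper (`--supports stmt-BirchSwinnertonDyer-21391 --as helper`). The stub
`stub_twistDatum` is NOT proved: its analytic content — a non-vanishing quadratic twist in the prescribed local
class `{d > 0, ord₃ d = 1}` for a (t′) curve of analytic rank one (Friedberg–Hoffstein, Ann. of Math. 142
(1995), Thm. B, general form; not in the tree, whose typed instances `waldspurger_exists_heegnerField_twist_ne_zero`,
`friedbergHoffstein_exists_twist_ne_zero_ramifiedAt`, `HoffsteinLuo1997_exists_twist_L_one_ne_zero` all exclude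
`3 ∣ d`) — is displayed here as an explicit HYPOTHESIS, and everything else is proved. BSD is not proved by any
of this; no route file is imported.

WHAT. `stub_twistDatum_of_nonvanishing` — GIVEN modularity (`exists_isNewformOf`, for the entire continuation of
`L(E^{(d)}, s)`) and the non-vanishing input `NV : ∀ W (t′) r_an = 1, ∃ d > 0, ord₃ d = 1, L(W^{(d)}, 1) ≠ 0`, the
body of the registered stub `stub_twistDatum` holds: take a global minimal model `Wd` of `W^{(d)}` (Néron /
Silverman *AEC* VIII.8.3, tree `hasGlobalMinimalModel_rat_holds`); it is non-CM (`j` is a twist invariant, tree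
`Additive.hasCM_iff_of_model_twist`), additive of class (t′) at `3` (companion file
`addv_and_subTprime_of_twist_three`: Kodaira `III ↔ III*`), and of analytic rank `0` (`analyticRank_smul`,
`analyticRank_eq_zero_iff_holds`).

References: J. H. Silverman, *AEC* VIII.8.3, X.5 Cor. 5.4; S. Friedberg, J. Hoffstein, Ann. of Math. 142 (1995)
Thm. B; C. Breuil, B. Conrad, F. Diamond, R. Taylor, J. Amer. Math. Soc. 14 (2001) Thm. A.
-/

-- D-0017: single-problem summit, so `Summit.BirchSwinnertonDyer.BirchSwinnertonDyer.…` repeats a namespace BY DESIGN.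
set_option linter.dupNamespace false

noncomputable section

open scoped NumberField

open IsDedekindDomain NumberField WeierstrassCurve
  Literature.NumberTheory.EllipticCurves Literature.NumberTheory.EllipticCurves.ModularForms
  Literature.NumberTheory.EllipticCurves.Rank1Residual
  Summit.BirchSwinnertonDyer.Rank1Residual.Additive

namespace Summit.BirchSwinnertonDyer.BirchSwinnertonDyer.Theorems.SolventPairLowerBound

/-- **`stub_twistDatum` from its analytic input.** Assume modularity (`exists_isNewformOf`) and the
non-vanishing input: every non-CM, globally minimal `W/ℚ`, additive of class (t′) at `3`, of analytic rank `1`,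
has an integer `d > 0` with `ord₃ d = 1` and `L(W^{(d)}, 1) ≠ 0` (Friedberg–Hoffstein 1995 Thm. B with the sign
`w(E^{(d)}) = +1` arranged inside the local class — NOT in the tree). Then the registered stub's conclusion holds:
there is such a `d` and a globally minimal model `Wd` of `W^{(d)}`, non-CM, additive of class (t′) at `3`, with
`r_an(Wd) = 0`. [cite: SilvermanAEC2009, VIII.8 Cor. 8.3 and X.5 Cor. 5.4]
[cite: FriedbergHoffstein1995, Thm. B] -/
theorem stub_twistDatum_of_nonvanishing (hmod : exists_isNewformOf)
    (NV : ∀ (W : WeierstrassCurve ℚ) [W.IsElliptic] [W.IsGloballyMinimal], ¬ W.HasCM → Addv W 3 →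
      Summit.BirchSwinnertonDyer.Rank1Residual.Additive.SubTprime W 3 → W.analyticRank = 1 →
      ∃ d : ℤ, 0 < d ∧ padicValInt 3 d = 1 ∧ (W.quadraticTwist (d : ℚ)).entireLFunction 1 ≠ 0) :
    ∀ (W : WeierstrassCurve ℚ) [W.IsElliptic] [W.IsGloballyMinimal],
    ¬ W.HasCM → Addv W 3 → Summit.BirchSwinnertonDyer.Rank1Residual.Additive.SubTprime W 3 → W.analyticRank = 1 →
    ∃ (d : ℤ) (Wd : WeierstrassCurve ℚ) (_ : Wd.IsElliptic) (_ : Wd.IsGloballyMinimal),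
      0 < d ∧ padicValInt 3 d = 1 ∧
      (∃ C : WeierstrassCurve.VariableChange ℚ, C • W.quadraticTwist (d : ℚ) = Wd) ∧
      ¬ Wd.HasCM ∧ Addv Wd 3 ∧ Summit.BirchSwinnertonDyer.Rank1Residual.Additive.SubTprime Wd 3 ∧
      Wd.analyticRank = 0 := by
  intro W _ _ hCM hadd hsub hr
  obtain ⟨d, hd0, hd3, hL⟩ := NV W hCM hadd hsub hr
  have hdq : (d : ℚ) ≠ 0 := by exact_mod_cast hd0.ne'
  haveI := W.isElliptic_quadraticTwist hdq
  obtain ⟨C, hC⟩ := hasGlobalMinimalModel_rat_holds (W.quadraticTwist (d : ℚ))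
  haveI : (C • W.quadraticTwist (d : ℚ)).IsGloballyMinimal := hC
  have htw : ∃ C' : WeierstrassCurve.VariableChange ℚ,
      C' • W.quadraticTwist (d : ℚ) = C • W.quadraticTwist (d : ℚ) := ⟨C, rfl⟩
  obtain ⟨haddd, hsubd⟩ :=
    addv_and_subTprime_of_twist_three W hadd hsub hd3 (C • W.quadraticTwist (d : ℚ)) htw
  refine ⟨d, C • W.quadraticTwist (d : ℚ), inferInstance, hC, hd0, hd3, htw, ?_, haddd, hsubd, ?_⟩
  · exact fun h ↦ hCM ((hasCM_iff_of_model_twist hdq htw).mp h)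
  · rw [analyticRank_smul]
    exact ((W.quadraticTwist (d : ℚ)).analyticRank_eq_zero_iff_holds
      (hasEntireLFunction_rat_of_exists_isNewformOf hmod _)).mpr hL

end Summit.BirchSwinnertonDyer.BirchSwinnertonDyer.Theorems.SolventPairLowerBound

end
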